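import Mathlib
import Summits.AtomisticToContinuum.HydrodynamicLimit.Theses.OneFlightGossipEngine
import Summits.AtomisticToContinuum.HydrodynamicLimit.Theorems.JParityClosureOddContactSymmetryGibbsInvariance
import Literature.Analysis.FluidPDE.HardSphereCollisionRecord
import Literature.MathematicalPhysics.KineticTheory.HardSphereTwoTimePressure

/-!
# Crux `EnergyCurrentTails` (stmt-AtomisticToContinuum-9235) — ideator 3, round 1: first lemmas

Two crux ideas are filed from this sketch (cards `loschmidt-tagging-exergy`, `ghost-tube-second-moment`).
Everything here is stated over existing declarations; the `theorem`s are proved, the `def … : Prop`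
are the checkable first statements of the two lines (not proved here).

* §1  Top-shell reduction (PROVED): the cubic tail above level `W` is bounded by
      `√(Σ‖vᵢ‖²) · Σ‖vᵢ‖²` and vanishes when no speed exceeds `W` — with the energy budget
      `Σ‖vᵢ‖² ≤ C(N+1)` this cuts the crux down to tagged tails on the moderate range
      `M ≤ ‖v‖ ≤ √(C log N)`.
* §2  Card A — the LOSCHMIDT TAGGING IDENTITY `TaggingIdentity` (exact duality: reversal +
      stationarity of the homogeneous Gibbs law; PROVED, `taggingIdentity_holds`), the transferred statement
      `ExergyInfluenceBound` (one-particle likelihood-ratio / exergy bound) and the docking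
      claim `ExergyDocking : TaggingIdentity → ExergyInfluenceBound → EnergyCurrentTails`.
* §3  Card B — the sure kinematic lemma `GhostEncounterForcesCollision` and the abstract
      second-moment inequality `PaleyZygmund` it is combined with.
-/

noncomputable section

open MeasureTheory Set Filter
open scoped ENNReal BigOperators RealInnerProductSpace

namespace Summit.AtomisticToContinuum.HydrodynamicLimit.Cruxes.EnergyCurrentTails.IdeatorThree

open Literature.MathematicalPhysics.KineticTheory Literature.Analysis.FluidPDE
open Summit.AtomisticToContinuum.HydrodynamicLimit.Theses.OneFlightGossipEngine

/-! ## §1 Top-shell reduction (pure finite-sum inequalities, proved) -/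

/-- Each speed is at most the square root of the total `Σ‖vᵢ‖²`. [folklore] -/
theorem norm_le_sqrt_sum_sq {n : ℕ} (v : Fin n → V3) (i : Fin n) :
    ‖v i‖ ≤ Real.sqrt (∑ j, ‖v j‖ ^ 2) := by
  refine Real.le_sqrt_of_sq_le ?_
  exact Finset.single_le_sum (f := fun j => ‖v j‖ ^ 2) (fun j _ => sq_nonneg _) (Finset.mem_univ i)

/-- **Top shell by the energy cap.** The cubic tail above any level `W` is at most
`√(Σ‖vⱼ‖²) · Σ‖vⱼ‖²` (no statistics: `‖vᵢ‖³ = ‖vᵢ‖·‖vᵢ‖²` and `‖vᵢ‖ ≤ √(Σ‖vⱼ‖²)`). [folklore] -/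
theorem cubicTail_le_sqrt_mul_energy {n : ℕ} (v : Fin n → V3) (W : ℝ) :
    (∑ i, Set.indicator {u : V3 | W < ‖u‖} (fun u => ‖u‖ ^ 3) (v i))
      ≤ Real.sqrt (∑ j, ‖v j‖ ^ 2) * ∑ i, ‖v i‖ ^ 2 := by
  rw [Finset.mul_sum]
  refine Finset.sum_le_sum fun i _ => ?_
  have hcube : ‖v i‖ ^ 3 ≤ Real.sqrt (∑ j, ‖v j‖ ^ 2) * ‖v i‖ ^ 2 := by
    calc ‖v i‖ ^ 3 = ‖v i‖ * ‖v i‖ ^ 2 := by ring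
      _ ≤ Real.sqrt (∑ j, ‖v j‖ ^ 2) * ‖v i‖ ^ 2 :=
          mul_le_mul_of_nonneg_right (norm_le_sqrt_sum_sq v i) (sq_nonneg _)
  by_cases h : W < ‖v i‖
  · rw [Set.indicator_of_mem (show v i ∈ {u : V3 | W < ‖u‖} from h)]
    exact hcube
  · rw [Set.indicator_of_notMem (show v i ∉ {u : V3 | W < ‖u‖} from h)]
    exact mul_nonneg (Real.sqrt_nonneg _) (sq_nonneg _)

/-- If no speed exceeds `W`, the cubic tail above `W` vanishes. [folklore] -/
theorem cubicTail_eq_zero_of_forall_le {n : ℕ} (v : Fin n → V3) (W : ℝ) (h : ∀ i, ‖v i‖ ≤ W) :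
    (∑ i, Set.indicator {u : V3 | W < ‖u‖} (fun u => ‖u‖ ^ 3) (v i)) = 0 := by
  refine Finset.sum_eq_zero fun i _ => ?_
  exact Set.indicator_of_notMem (show v i ∉ {u : V3 | W < ‖u‖} from not_lt.2 (h i)) _

/-- **Top-shell reduction, combined form**: the cubic tail above `W` is bounded by the energy
expression times the indicator that SOME sphere is faster than `W`.  Consequence for the crux
(used by both cards): on the event `Σ‖vᵢ(s)‖² ≤ 2C(N+1)` (exponentially likely under local Gibbs
data and conserved by the flow) the per-particle cubic tail above `W_N = √(C' log N)` is at most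
`(2C)^{3/2}(N+1)^{1/2}·𝟙{maxᵢ‖vᵢ(s)‖ > W_N}`, so a tagged tail bound `P(‖v₁(s)‖ > W_N) = o(N^{-3/2})`
disposes of the top, and only the moderate range `M ≤ ‖v‖ ≤ W_N` remains. [folklore] -/
theorem cubicTail_le_indicator_energy {n : ℕ} (v : Fin n → V3) (W : ℝ) :
    (∑ i, Set.indicator {u : V3 | W < ‖u‖} (fun u => ‖u‖ ^ 3) (v i))
      ≤ (if ∃ i, W < ‖v i‖ then Real.sqrt (∑ j, ‖v j‖ ^ 2) * ∑ i, ‖v i‖ ^ 2 else 0) := by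
  split_ifs with h
  · exact cubicTail_le_sqrt_mul_energy v W
  · push Not at h
    rw [cubicTail_eq_zero_of_forall_le v W h]

/-! ## §2 Card A — Loschmidt tagging and the exergy influence bound -/

/-- **LOSCHMIDT TAGGING IDENTITY** (first lemma of card `loschmidt-tagging-exergy`; provable now).
Let `G = localGibbsLaw σ a 0 θ` be the homogeneous canonical Gibbs law (constant activity `a`, zero
drift, temperature `θ`): it is preserved by every hard-sphere flow map
(`Theorems.measurePreserving_flow_localGibbsLaw_const`), preserved by the velocity flip `flipVel`
(its density is a function of `Σ‖vᵢ‖²`), and the flow is reversible Liouville-a.e.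
(`flow_flipVel_ae`: `Φ_t ∘ flip = flip ∘ Φ_{-t}`).  Hence for every density `F ≥ 0`, every even
one-particle velocity observable `g ≥ 0`, every time `s` and particle `i`:
`∫ F(z)·g(vᵢ(Φ_s z)) dG = ∫ g(vᵢ(z))·F(flip(Φ_s z)) dG` —
"the tagged velocity law at time `s` of the evolution started from `F·G` is the time-0 tagged law of
the EQUILIBRIUM gas re-weighted by the flipped density evaluated at time `s`". With
`F = d(localGibbsLaw σ a₀ u₀ θ₀)/dG` this expresses the crux's integrand through a one-particle
likelihood ratio under the invariant law. [folklore] -/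
def TaggingIdentity : Prop :=
  ∀ (σ a θ : ℝ), 0 < σ → 0 < a → 0 < θ → ∀ (N : ℕ)
    (Φ : HardSphereFlow (Torus.geometry (Fin 3)) (hsDiameter σ N) (N + 1))
    (F : Config (N + 1) (Fin 3) T3 → ℝ≥0∞), Measurable F →
    ∀ (g : V3 → ℝ≥0∞), Measurable g → (∀ v, g (-v) = g v) →
    ∀ (s : ℝ) (i : Fin (N + 1)),
      ∫⁻ z, F z * g ((Φ.flow s z i).2) ∂(localGibbsLaw σ (fun _ => a) (fun _ => 0) (fun _ => θ) N Φ)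
        = ∫⁻ z, g ((z i).2) * F (flipVel (Φ.flow s z))
            ∂(localGibbsLaw σ (fun _ => a) (fun _ => 0) (fun _ => θ) N Φ)

/-- **The Loschmidt tagging identity holds** (PROVED: substitute `z = Φ_{-s} w` using the
invariance of the homogeneous Gibbs law under the flow
(`Theorems.measurePreserving_flow_localGibbsLaw_const`), cancel `Φ_s Φ_{-s}` on the good set, rewrite
`Φ_{-s} w = flip (Φ_s (flip w))` a.e. (`ae_flow_flipVel_localGibbsLaw`, CIP 1994 §4.2 (2.3)),
substitute `w = flip w'` (`measurePreserving_flipVel_localGibbsLaw`), and use evenness of `g`).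
[folklore] -/
theorem taggingIdentity_holds : TaggingIdentity := by
  intro σ a θ _hσ _ha _hθ N Φ F hF g hg hgeven s i
  have hSe := measurableEmbedding_flipVel (X := T3) (d := Fin 3) (N := N + 1)
  have hR := measurePreserving_flipVel_localGibbsLaw σ (fun _ => a) (fun _ => θ) N Φ
  have hΦ := Summit.AtomisticToContinuum.HydrodynamicLimit.Theorems.measurePreserving_flow_localGibbsLaw_const
    σ a θ (0 : V3) N Φ (-s)
  have hrev := ae_flow_flipVel_localGibbsLaw σ (fun _ => a) (fun _ => (0 : V3)) (fun _ => θ) N Φ s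
  have hgood := ae_mem_good_localGibbsLaw σ (fun _ => a) (fun _ => (0 : V3)) (fun _ => θ) N Φ
  have hvel : ∀ t : ℝ, Measurable fun z : Config (N + 1) (Fin 3) T3 => (Φ.flow t z i).2 := fun t =>
    measurable_snd.comp ((measurable_pi_apply i).comp (Φ.measurable_flow t))
  have hh : Measurable fun z : Config (N + 1) (Fin 3) T3 => F z * g ((Φ.flow s z i).2) :=
    hF.mul (hg.comp (hvel s))
  calc ∫⁻ z, F z * g ((Φ.flow s z i).2) ∂(localGibbsLaw σ (fun _ => a) (fun _ => 0) (fun _ => θ) N Φ)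
      = ∫⁻ w, F (Φ.flow (-s) w) * g ((Φ.flow s (Φ.flow (-s) w) i).2)
          ∂(localGibbsLaw σ (fun _ => a) (fun _ => 0) (fun _ => θ) N Φ) := by
        rw [← lintegral_map hh (Φ.measurable_flow (-s)), hΦ.map_eq]
    _ = ∫⁻ w, F (Φ.flow (-s) w) * g ((w i).2)
          ∂(localGibbsLaw σ (fun _ => a) (fun _ => 0) (fun _ => θ) N Φ) := by
        refine lintegral_congr_ae ?_
        filter_upwards [hgood] with w hw
        have h1 := Φ.flow_neg_flow (-s) hw
        rw [neg_neg] at h1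
        rw [h1]
    _ = ∫⁻ w, F (flipVel (Φ.flow s (flipVel w))) * g ((w i).2)
          ∂(localGibbsLaw σ (fun _ => a) (fun _ => 0) (fun _ => θ) N Φ) := by
        refine lintegral_congr_ae ?_
        filter_upwards [hrev] with w hw
        rw [hw, flipVel_flipVel]
    _ = ∫⁻ w, F (flipVel (Φ.flow s (flipVel (flipVel w)))) * g (((flipVel w) i).2)
          ∂(localGibbsLaw σ (fun _ => a) (fun _ => 0) (fun _ => θ) N Φ) :=
        (hR.lintegral_comp_emb hSe
          (fun w => F (flipVel (Φ.flow s (flipVel w))) * g ((w i).2))).symm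
    _ = ∫⁻ z, g ((z i).2) * F (flipVel (Φ.flow s z))
          ∂(localGibbsLaw σ (fun _ => a) (fun _ => 0) (fun _ => θ) N Φ) := by
        refine lintegral_congr fun w => ?_
        rw [flipVel_flipVel, mul_comm]
        show g (-(w i).2) * _ = _
        rw [hgeven]

/-- **EXERGY INFLUENCE BOUND** (the transferred statement `C⁺` of card `loschmidt-tagging-exergy`;
OPEN — the line's crux-level content).  In the frame of `EnergyCurrentTails`: for every `t < T`
there are a homogeneous reference `G = localGibbsLaw σ a 0 θr`, a rate `β < 1/θr`, a constant
`C` and `N₀` such that for all `N ≥ N₀`, `s ∈ [0,t]`, the local Gibbs law has a density `F`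
w.r.t. `G` and, TESTED AGAINST EVERY one-particle velocity observable `g ≥ 0`,
`∫ g(vᵢ) · F(flip(Φ_s z)) dG ≤ C ∫ g(vᵢ) e^{β‖vᵢ‖²/2} dG` — i.e. the one-particle likelihood ratio
`Λ_s(x,v) = E_G[F∘flip∘Φ_s | zᵢ = (x,v)]` of the (flipped) local-Gibbs tilt, seen by ONE planted
particle, grows at most like `e^{β‖v‖²/2}` with `βθr < 1`: one fast sphere can raise the
likelihood of the macrostate by no more than its exergy.  With `TaggingIdentity` this says the
tagged velocity law at time `s` is dominated by `C·M_{θ'}`, `1/θ' = 1/θr − β > 0` (Gaussian tails),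
hence the cubic uniform integrability of the crux. [conjecture of this card] -/
def ExergyInfluenceBound : Prop :=
  ∀ (a₀ θ₀ : T3 → ℝ) (u₀ : T3 → V3), Continuous a₀ → Continuous θ₀ → Continuous u₀ →
    (∀ x, 0 < a₀ x) → (∀ x, 0 < θ₀ x) →
    ∃ σ₀ : ℝ, 0 < σ₀ ∧ ∀ σ : ℝ, 0 < σ → σ < σ₀ →
      ∀ (T : ℝ) (ρ θ : ℝ → T3 → ℝ) (u : ℝ → T3 → V3), IsHardSphereEulerSolution σ T ρ u θ →
        ∀ Φ : (N : ℕ) → HardSphereFlow (Torus.geometry (Fin 3)) (hsDiameter σ N) (N + 1),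
          TendstoHydroFieldsAt (fun N => localGibbsLaw σ a₀ u₀ θ₀ N (Φ N)) Φ ρ u θ 0 →
            ∀ t ∈ Set.Ico 0 T, ∃ a θr β C : ℝ, 0 < a ∧ 0 < θr ∧ β * θr < 1 ∧ 0 ≤ C ∧
              ∃ N₀ : ℕ, ∀ N : ℕ, N₀ ≤ N → ∀ s ∈ Set.Icc 0 t,
                ∃ F : Config (N + 1) (Fin 3) T3 → ℝ≥0∞, Measurable F ∧
                  localGibbsLaw σ a₀ u₀ θ₀ N (Φ N)
                    = (localGibbsLaw σ (fun _ => a) (fun _ => 0) (fun _ => θr) N (Φ N)).withDensity F ∧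
                  ∀ (i : Fin (N + 1)) (g : V3 → ℝ≥0∞), Measurable g →
                    ∫⁻ z, g ((z i).2) * F (flipVel ((Φ N).flow s z))
                        ∂(localGibbsLaw σ (fun _ => a) (fun _ => 0) (fun _ => θr) N (Φ N))
                      ≤ ENNReal.ofReal C *
                        ∫⁻ z, g ((z i).2) * ENNReal.ofReal (Real.exp (β * ‖(z i).2‖ ^ 2 / 2))
                          ∂(localGibbsLaw σ (fun _ => a) (fun _ => 0) (fun _ => θr) N (Φ N))

/-- **Docking claim of card A** (bookkeeping, expected provable once stated: the identity turns the
crux's integrand, particle by particle, into the tested form bounded by `ExergyInfluenceBound`; the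
right-hand side is `C·∫ g dM_{θ'}` with `θ' = θr/(1-βθr)`, a fixed Gaussian, whose cubic tail above
`M` tends to `0`; sum over `i`, divide by `N+1`).  The mathematics of the line is in
`ExergyInfluenceBound`. [conjecture of this card] -/
def ExergyDocking : Prop :=
  TaggingIdentity → ExergyInfluenceBound → EnergyCurrentTails

/-! ## §3 Card B — ghost tubes and the second-moment method -/

/-- **GHOST ENCOUNTER FORCES A COLLISION** (first lemma of card `ghost-tube-second-moment`; sure,
provable now from the `free`/`mem` fields of `IsHardSphereTrajectory`).  Along a good orbit, let the
GHOST of sphere `i` from time `r` be its free flight `x_i(r) + (t-r)v_i(r)` (on the torus: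
`translate`).  If at some later time `t₁` some other sphere `j` (following its TRUE motion) comes
within one diameter of the ghost, then `i` has a collision in `(r, t₁]`: either `i` collided before
`t₁`, or it did not, in which case it IS its ghost at `t₁` (particles fly freely between their own
collisions) and is in contact with `j` (`‖sep‖ ≤ ε` and the hard-sphere domain force `= ε`), so
`t₁` itself is a collision time of `i`.  This converts "no channelling" (an `N`-body void event)
into the positivity of a COUNT — the number of ghost encounters — to which the second-moment
method applies. [folklore] -/
def GhostEncounterForcesCollision : Prop :=
  ∀ (σ : ℝ) (N : ℕ) (Φ : HardSphereFlow (Torus.geometry (Fin 3)) (hsDiameter σ N) (N + 1))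
    (z : Config (N + 1) (Fin 3) T3), z ∈ Φ.good →
    ∀ (i j : Fin (N + 1)), i ≠ j → ∀ (r t₁ : ℝ), r < t₁ →
      ‖(Torus.geometry (Fin 3)).sepVec ((Φ.flow t₁ z) j).1
          ((Torus.geometry (Fin 3)).translate ((Φ.flow r z) i).1 ((t₁ - r) • ((Φ.flow r z) i).2))‖
        ≤ hsDiameter σ N →
      (collisionTimesOf (Torus.geometry (Fin 3)) (hsDiameter σ N) (fun t => Φ.flow t z) i
        ∩ Set.Ioc r t₁).Nonempty

/-- **Paley–Zygmund / second-moment inequality** in the `lintegral` form the line consumes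
(PROVED; Cauchy–Schwarz `∫X = ∫X·𝟙{X≠0} ≤ (∫X²)^{1/2} μ{X≠0}^{1/2}` via
`ENNReal.lintegral_mul_le_Lp_mul_Lq`).  Applied with `X` = number of ghost encounters of a fast
tagged sphere in a window of one free path, conditionally on the tagged state: a LOWER bound on its
(two-point) mean and an UPPER bound on its (three-point) second moment give a collision probability
`≥ (EX)²/E X² > 0` per window, uniformly in the speed. [folklore] -/
theorem paleyZygmund_lintegral {α : Type*} [MeasurableSpace α] (μ : Measure α) (X : α → ℝ≥0∞)
    (hX : Measurable X) :
    (∫⁻ a, X a ∂μ) ^ 2 ≤ μ {a | X a ≠ 0} * ∫⁻ a, X a ^ 2 ∂μ := by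
  classical
  set S : Set α := {a | X a ≠ 0} with hS
  have hSm : MeasurableSet S := hX (measurableSet_singleton 0).compl
  -- X = X * 1_S
  have hXS : ∀ a, X a = X a * S.indicator (fun _ => (1 : ℝ≥0∞)) a := by
    intro a
    by_cases ha : X a = 0
    · simp [ha]
    · rw [Set.indicator_of_mem (show a ∈ S from ha), mul_one]
  have hpq : Real.HolderConjugate 2 2 := by
    constructor <;> norm_num
  have key := ENNReal.lintegral_mul_le_Lp_mul_Lq μ hpq hX.aemeasurable
    ((measurable_const.indicator hSm).aemeasurable : AEMeasurable (S.indicator fun _ => (1:ℝ≥0∞)) μ)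
  have hind : ∫⁻ a, (S.indicator (fun _ => (1 : ℝ≥0∞)) a) ^ (2 : ℝ) ∂μ = μ S := by
    have : ∀ a, (S.indicator (fun _ => (1 : ℝ≥0∞)) a) ^ (2 : ℝ) = S.indicator (fun _ => (1 : ℝ≥0∞)) a := by
      intro a; by_cases ha : a ∈ S
      · simp [Set.indicator_of_mem ha]
      · simp [Set.indicator_of_notMem ha]
    simp_rw [this]
    rw [lintegral_indicator hSm]
    simp
  have hlhs : ∫⁻ a, X a ∂μ = ∫⁻ a, (X * S.indicator fun _ => (1 : ℝ≥0∞)) a ∂μ := by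
    refine lintegral_congr fun a => ?_
    simp only [Pi.mul_apply]
    exact hXS a
  rw [hlhs]
  calc (∫⁻ a, (X * S.indicator fun _ => (1 : ℝ≥0∞)) a ∂μ) ^ 2
      ≤ ((∫⁻ a, X a ^ (2:ℝ) ∂μ) ^ (1 / (2:ℝ)) * (∫⁻ a, (S.indicator (fun _ => (1 : ℝ≥0∞)) a) ^ (2:ℝ) ∂μ) ^ (1 / (2:ℝ))) ^ 2 := by
        gcongr
    _ = μ S * ∫⁻ a, X a ^ 2 ∂μ := by
        rw [hind, mul_pow, ← ENNReal.rpow_natCast, ← ENNReal.rpow_natCast, ← ENNReal.rpow_mul,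
          ← ENNReal.rpow_mul]
        norm_num
        rw [mul_comm]

/-- **One-step shell contraction** (the closing arithmetic of card B, elementary real analysis,
provable now): a nonnegative sequence with `x_{k+1} ≤ q·x_k + b`, `0 ≤ q < 1`, stays below
`max x₀ (b/(1-q))`.  In the line: `x_k` = expected cubic tail of one speed shell at the `k`-th
window, `q = 1 - p₀(1 - ρ₃) < 1` from a collision probability `p₀ > 0` per window (ghost tube +
Paley–Zygmund) and a retention factor `ρ₃ < 1` per collision (impact anti-concentration), `b` =
feed from lower shells and thermal partners. [folklore] -/
theorem contraction_bound {q b : ℝ} (hq0 : 0 ≤ q) (hq1 : q < 1) (x : ℕ → ℝ)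
    (hx0 : 0 ≤ x 0) (hstep : ∀ k, x (k + 1) ≤ q * x k + b) :
    ∀ k, x k ≤ max (x 0) (b / (1 - q)) := by
  have h1q : 0 < 1 - q := by linarith
  intro k
  induction k with
  | zero => exact le_max_left _ _
  | succ k ih =>
    have hM : b / (1 - q) ≤ max (x 0) (b / (1 - q)) := le_max_right _ _
    have hfix : q * (b / (1 - q)) + b = b / (1 - q) := by
      field_simp
      ring
    have hMnonneg : 0 ≤ max (x 0) (b / (1 - q)) := le_trans hx0 (le_max_left _ _)
    calc x (k + 1) ≤ q * x k + b := hstep k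
      _ ≤ q * max (x 0) (b / (1 - q)) + b := by nlinarith [ih]
      _ ≤ max (x 0) (b / (1 - q)) := by
          -- `q·M + b ≤ M` iff `b ≤ (1-q)M` iff `b/(1-q) ≤ M`
          have : b ≤ (1 - q) * max (x 0) (b / (1 - q)) := by
            rw [← div_le_iff₀' h1q]; exact hM
          nlinarith [this]

end Summit.AtomisticToContinuum.HydrodynamicLimit.Cruxes.EnergyCurrentTails.IdeatorThree

end
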